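import Mathlib
import Summits.CriticalPhenomena.PercolationContinuityZ3.Theorems.PercNearOneGluingNearOneGluingPivotalityDomination
import Summits.CriticalPhenomena.PercolationContinuityZ3.Theorems.PercNearOneGluingAdditiveGluingOneBond
import Literature.Probability.LatticeModels.ProdBernoulliClusterLocality
import Literature.Probability.Percolation.PercolationEvents
import HarnessLib

/-!
# Crux `PercNearOneGluing.NearOneGluing` (stmt-CriticalPhenomena-4574), line `SketchR2I5` — stub `stub_lrfDepthOneSeq`

Helper file for the crux (lead prover-line-stmt-CriticalPhenomena-4574-c3, cycle 3): the
**least-reliable-first gluing inequality at depth one, sequential form, any number of relays**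
(the depth-one case of the LRF programme).  Proves exactly the registered stub signature; lands
with `--supports stmt-CriticalPhenomena-4574`.

## Content

Weighted complete graph on `Fin n`, `μ = prodBernoulli w` on bond configurations
`ω : Set (Sym2 (Fin n))`.  Every positive-weight neighbour of `o` is one of the relays
`a 0, …, a (k-1)` (injective, `≠ o`), and the relays are ordered sequentially: `a j` is the least
reliable among `a j, …, a (k-1)` for the weights `w_j` obtained from `w` by zeroing the pairs
`s(o, a l)`, `l < j`.  Then, with `p_i = w s(o, a i)`,
`μ(o ↮ b, ∃ i, o ↔ a i) ≤ Σ_i p_i ∏_{l<i} (1 − p_l) · μ(a i ↮ b)`.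

Proof: induction on `k`.  For `k + 1` relays put `e₀ = s(o, a 0)`, `p = p₀`,
`μ⁻ = prodBernoulli (w[e₀ ↦ 0])`, `μ⁺ = prodBernoulli (w[e₀ ↦ 1])`, `D_i = {a i ↮ b}`.
* `μ(bad ∩ {e₀ open}) ≤ μ(D₀ ∩ {e₀ open}) = p μ⁺(D₀)` (`goodStepEI_real_inter_open_eq`);
* `μ(bad ∩ {e₀ closed}) = (1 − p) μ⁻(bad)` (`goodStepEI_real_inter_closed_eq`) and
  `μ⁻(bad) ≤ μ⁻(bad')` where `bad'` only asks for `o ↔ a i`, `i ≥ 1`: under `μ⁻` almost surely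
  every weight-zero pair is closed (`prodBernoulli_ae_forall_notMem`), so the first pair of an
  open path from `o` is some `s(o, a i)` with `i ≥ 1`;
* the induction hypothesis for `(w[e₀ ↦ 0], a ∘ Fin.succ)` (its sequential hypothesis is the
  given one at `j + 1`) bounds `μ⁻(bad')` by `Σ_{i ≥ 1} π'_i μ⁻(D_i)`;
* `μ(D_i) = (1 − p) μ⁻(D_i) + p μ⁺(D_i)` (`stub_oneBondDecomp_k15`) and
  `μ(D_i) − μ⁺(D_i) = μ(L_i)`, `L_i = {ω ∉ a i ↔ b, insert e₀ ω ∈ a i ↔ b}` (push-forward of `μ`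
  under `insert e₀`, `goodStepEI_prodBernoulli_map_insert`);
* `μ(L_i) ≤ μ(L_0)` for `i ≥ 1` (`stub_pivotalityDomination`, sequential hypothesis at `j = 0`)
  and `Σ_{i ≥ 1} π'_i ≤ 1`, whence TARGET − BOUND `= p (μ(L_0) − Σ_{i≥1} π'_i μ(L_i)) ≥ 0`.
-/

namespace Summit.CriticalPhenomena.PercolationContinuityZ3.Theorems

open MeasureTheory Set Literature.Probability.LatticeModels Literature.Probability.Percolation
open scoped Classical BigOperators

namespace LrfDepthOneSeq

/-! ### Combinatorial helpers -/

/-- An open path from `o` to a different vertex starts with an open non-loop pair `s(o, y)`.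
[folklore] -/
theorem exists_first_pair {V : Type*} {ω : Set (Sym2 V)} {o x : V} (hxo : x ≠ o)
    (h : (openGraph ω).Reachable o x) : ∃ y, s(o, y) ∈ ω ∧ o ≠ y := by
  obtain ⟨p⟩ := h
  cases p with
  | nil => exact absurd rfl hxo
  | cons hadj _ =>
    obtain ⟨hmem, hne⟩ := (openGraph_adj ω _ _).1 hadj
    exact ⟨_, hmem, hne⟩

/-- Splitting off the index `0` from a product over `{l : Fin (k+1) | l < i.succ}`. [folklore] -/
theorem prod_filter_lt_succ {k : ℕ} (f : Fin (k + 1) → ℝ) (i : Fin k) :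
    ∏ l ∈ Finset.univ.filter (fun l : Fin (k + 1) => l < i.succ), f l =
      f 0 * ∏ l ∈ Finset.univ.filter (fun l : Fin k => l < i), f l.succ := by
  rw [Finset.prod_filter, Finset.prod_filter, Fin.prod_univ_succ, if_pos (Fin.succ_pos i)]
  simp only [Fin.succ_lt_succ_iff]

/-- The survival product over `{l : Fin (k+1) | l < 0}` is empty:
`∏_{l < 0} (1 − q_l) = 1`. [folklore] -/
theorem prod_filter_lt_zero_one_sub {k : ℕ} (q : Fin (k + 1) → ℝ) :
    ∏ l ∈ Finset.univ.filter (fun l : Fin (k + 1) => l < 0), (1 - q l) = 1 := by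
  have h : Finset.univ.filter (fun l : Fin (k + 1) => l < 0) = ∅ := by
    ext l
    simp only [Finset.mem_filter, Finset.mem_univ, true_and, Finset.notMem_empty, iff_false]
    exact Fin.not_lt_zero l
  rw [h, Finset.prod_empty]

/-- **Sub-probability of the sequential hitting distribution**:
`Σ_i q_i ∏_{l<i} (1 − q_l) ≤ 1` for `q_i ∈ [0, 1]` (it equals `1 − ∏_i (1 − q_i)`). [folklore] -/
theorem sum_mul_prod_le_one : ∀ (k : ℕ) (q : Fin k → ℝ), (∀ i, 0 ≤ q i) → (∀ i, q i ≤ 1) →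
    ∑ i, q i * ∏ l ∈ Finset.univ.filter (fun l : Fin k => l < i), (1 - q l) ≤ 1 := by
  intro k
  induction k with
  | zero => intro q _ _; simp
  | succ k ih =>
    intro q hq0 hq1
    rw [Fin.sum_univ_succ, prod_filter_lt_zero_one_sub, mul_one]
    have h := ih (fun i => q i.succ) (fun i => hq0 _) (fun i => hq1 _)
    have hrw : ∀ i : Fin k,
        q i.succ * ∏ l ∈ Finset.univ.filter (fun l : Fin (k + 1) => l < i.succ), (1 - q l) =
          (1 - q 0) *
            (q i.succ * ∏ l ∈ Finset.univ.filter (fun l : Fin k => l < i), (1 - q l.succ)) := by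
      intro i
      rw [prod_filter_lt_succ (fun l => 1 - q l) i]
      ring
    rw [Finset.sum_congr rfl fun i _ => hrw i, ← Finset.mul_sum]
    have h1 : 0 ≤ 1 - q 0 := sub_nonneg.2 (hq1 0)
    nlinarith [mul_le_mul_of_nonneg_left h h1]

/-- **The bookkeeping of the induction step** (pure real arithmetic): with
`M_i = (1 − p) A_i + p B_i`, `L_i = M_i − B_i ≤ L₀ = M₀ − B₀`, `Σ q_i P_i ≤ 1`,
`bad ≤ p B₀ + (1 − p) bad⁻` and `bad⁻ ≤ Σ q_i P_i A_i`, one has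
`bad ≤ p M₀ + Σ q_i ((1 − p) P_i) M_i`. [folklore] -/
theorem algebra {k : ℕ} {p M₀ B₀ L₀ bad badm : ℝ} {q P A B M L : Fin k → ℝ}
    (hp0 : 0 ≤ p) (hp1 : p ≤ 1) (hπ0 : ∀ i, 0 ≤ q i * P i) (hπ1 : ∑ i, q i * P i ≤ 1)
    (hM : ∀ i, M i = (1 - p) * A i + p * B i) (hL : ∀ i, L i = M i - B i)
    (hL₀ : L₀ = M₀ - B₀) (hL₀nn : 0 ≤ L₀) (hdom : ∀ i, L i ≤ L₀)
    (hbad : bad ≤ p * B₀ + (1 - p) * badm) (hIH : badm ≤ ∑ i, q i * P i * A i) :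
    bad ≤ p * 1 * M₀ + ∑ i, q i * ((1 - p) * P i) * M i := by
  have h1 : ∑ i, q i * ((1 - p) * P i) * M i =
      (1 - p) * ∑ i, q i * P i * A i - p * ∑ i, q i * P i * L i := by
    rw [Finset.mul_sum, Finset.mul_sum, ← Finset.sum_sub_distrib]
    refine Finset.sum_congr rfl fun i _ => ?_
    linear_combination (q i * P i) * hM i + (p * (q i * P i)) * hL i
  have h2 : ∑ i, q i * P i * L i ≤ L₀ :=
    calc ∑ i, q i * P i * L i ≤ ∑ i, q i * P i * L₀ :=
          Finset.sum_le_sum fun i _ => mul_le_mul_of_nonneg_left (hdom i) (hπ0 i)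
      _ = (∑ i, q i * P i) * L₀ := by rw [Finset.sum_mul]
      _ ≤ 1 * L₀ := mul_le_mul_of_nonneg_right hπ1 hL₀nn
      _ = L₀ := one_mul _
  have h3 : (1 - p) * badm ≤ (1 - p) * ∑ i, q i * P i * A i :=
    mul_le_mul_of_nonneg_left hIH (sub_nonneg.2 hp1)
  have h4 : p * ∑ i, q i * P i * L i ≤ p * L₀ := mul_le_mul_of_nonneg_left h2 hp0
  have h5 : p * L₀ = p * M₀ - p * B₀ := by rw [hL₀]; ring
  rw [h1]
  linarith

end LrfDepthOneSeq

open LrfDepthOneSeq in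
/-- **Least-reliable-first at depth one, sequential form, all `|A|`** (the depth-one case of the
LRF programme): if every positive-weight neighbour of `o` is among the relays `a i` (injective,
`≠ o`), ordered so that `a j` is the least reliable of `a j, …, a (k-1)` after zeroing the pairs
`s(o, a l)`, `l < j`, then
`μ(o ↮ b, ∃ i, o ↔ a i) ≤ Σ_i p_i ∏_{l<i} (1 − p_l) · μ(a i ↮ b)`, `p_i = w s(o, a i)`. -/
theorem stub_lrfDepthOneSeq :
    ∀ (n k : ℕ) (w : Sym2 (Fin n) → unitInterval) (o b : Fin n) (a : Fin k → Fin n),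
      Function.Injective a → (∀ i, a i ≠ o) →
      (∀ x : Fin n, x ≠ o → w s(o, x) ≠ 0 → ∃ i, a i = x) →
      (∀ j i : Fin k, j < i →
        (prodBernoulli (fun e => if ∃ l : Fin k, l < j ∧ e = s(o, a l) then 0 else w e)).real
            (openConn (a j) b) ≤
          (prodBernoulli (fun e => if ∃ l : Fin k, l < j ∧ e = s(o, a l) then 0 else w e)).real
            (openConn (a i) b)) →
      (prodBernoulli w).real {ω | ω ∉ openConn o b ∧ ∃ i, ω ∈ openConn o (a i)} ≤
        ∑ i : Fin k, (w s(o, a i) : ℝ) * (∏ l ∈ Finset.univ.filter (fun l : Fin k => l < i), (1 - (w s(o, a l) : ℝ))) *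
          (prodBernoulli w).real (openConn (a i) b)ᶜ := by
  intro n k
  induction k with
  | zero =>
    intro w o b a _ _ _ _
    simp
  | succ k ih =>
    intro w o b a hinj hao hdep hadm
    -- the first probed pair and the two modified weights
    have hp0 : 0 ≤ (w s(o, a 0) : ℝ) := (w s(o, a 0)).2.1
    have hp1 : (w s(o, a 0) : ℝ) ≤ 1 := (w s(o, a 0)).2.2
    have hpair : ∀ i : Fin k, s(o, a i.succ) ≠ s(o, a 0) := fun i h =>
      Fin.succ_ne_zero i (hinj (Sym2.congr_right.1 h))
    have hwm_succ : ∀ i : Fin k,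
        Function.update w s(o, a 0) 0 s(o, a i.succ) = w s(o, a i.succ) := fun i =>
      Function.update_of_ne (hpair i) _ _
    -- ### the induction hypothesis for `(w[e₀ ↦ 0], a ∘ succ)`
    have hdep' : ∀ x : Fin n, x ≠ o → Function.update w s(o, a 0) 0 s(o, x) ≠ 0 →
        ∃ i : Fin k, (fun i : Fin k => a i.succ) i = x := by
      intro x hxo hx
      have hne : s(o, x) ≠ s(o, a 0) := by
        intro h
        rw [h, Function.update_self] at hx
        exact hx rfl
      rw [Function.update_of_ne hne] at hx
      obtain ⟨j, rfl⟩ := hdep x hxo hx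
      have hj : j ≠ 0 := by
        rintro rfl
        exact hne rfl
      obtain ⟨j', rfl⟩ := Fin.exists_succ_eq.2 hj
      exact ⟨j', rfl⟩
    have hW : ∀ j' : Fin k,
        (fun e => if ∃ l : Fin k, l < j' ∧ e = s(o, (fun i : Fin k => a i.succ) l) then
            (0 : unitInterval) else Function.update w s(o, a 0) 0 e) =
          (fun e => if ∃ l : Fin (k + 1), l < j'.succ ∧ e = s(o, a l) then
            (0 : unitInterval) else w e) := by
      intro j'
      funext e
      by_cases he : e = s(o, a 0)
      · have h2 : ∃ l : Fin (k + 1), l < j'.succ ∧ e = s(o, a l) := ⟨0, Fin.succ_pos j', he⟩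
        rw [if_pos h2]
        split_ifs
        · rfl
        · rw [he, Function.update_self]
      · have hiff : (∃ l : Fin k, l < j' ∧ e = s(o, (fun i : Fin k => a i.succ) l)) ↔
            (∃ l : Fin (k + 1), l < j'.succ ∧ e = s(o, a l)) := by
          constructor
          · rintro ⟨l, hl, rfl⟩
            exact ⟨l.succ, Fin.succ_lt_succ_iff.2 hl, rfl⟩
          · rintro ⟨l, hl, rfl⟩
            cases l using Fin.cases with
            | zero => exact absurd rfl he
            | succ l' => exact ⟨l', Fin.succ_lt_succ_iff.1 hl, rfl⟩
        by_cases hc : ∃ l : Fin k, l < j' ∧ e = s(o, (fun i : Fin k => a i.succ) l)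
        · rw [if_pos hc, if_pos (hiff.1 hc)]
        · rw [if_neg hc, if_neg (fun h => hc (hiff.2 h)), Function.update_of_ne he]
    have hadm' : ∀ j' i' : Fin k, j' < i' →
        (prodBernoulli (fun e => if ∃ l : Fin k, l < j' ∧ e = s(o, (fun i : Fin k => a i.succ) l)
            then 0 else Function.update w s(o, a 0) 0 e)).real
            (openConn ((fun i : Fin k => a i.succ) j') b) ≤
          (prodBernoulli (fun e => if ∃ l : Fin k, l < j' ∧ e = s(o, (fun i : Fin k => a i.succ) l)
            then 0 else Function.update w s(o, a 0) 0 e)).real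
            (openConn ((fun i : Fin k => a i.succ) i') b) := by
      intro j' i' hlt
      rw [hW j']
      exact hadm j'.succ i'.succ (Fin.succ_lt_succ_iff.2 hlt)
    have hIH := ih (Function.update w s(o, a 0) 0) o b (fun i : Fin k => a i.succ)
      (hinj.comp (Fin.succ_injective _)) (fun i => hao _) hdep' hadm'
    simp only [hwm_succ] at hIH
    -- ### the events
    -- `bad ∩ {e₀ open} ⊆ D₀ ∩ {e₀ open}`
    have hopen : {ω : Set (Sym2 (Fin n)) | ω ∉ openConn o b ∧ ∃ i, ω ∈ openConn o (a i)} ∩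
          {ω | s(o, a 0) ∈ ω} ⊆ (openConn (a 0) b)ᶜ ∩ {ω | s(o, a 0) ∈ ω} := by
      rintro ω ⟨⟨hnb, -⟩, he⟩
      refine ⟨fun h => hnb ?_, he⟩
      exact ((openGraph_adj ω o (a 0)).2 ⟨he, (hao 0).symm⟩).reachable.trans h
    -- `μ⁻(bad) ≤ μ⁻(bad')` (a.s. every weight-zero pair is closed)
    have hae := prodBernoulli_ae_forall_notMem (Function.update w s(o, a 0) 0)
      (Set.toFinite {e : Sym2 (Fin n) | Function.update w s(o, a 0) 0 e = 0}).countable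
      (fun e he => he)
    have hclosed : (prodBernoulli (Function.update w s(o, a 0) 0)).real
          {ω : Set (Sym2 (Fin n)) | ω ∉ openConn o b ∧ ∃ i, ω ∈ openConn o (a i)} ≤
        (prodBernoulli (Function.update w s(o, a 0) 0)).real
          {ω : Set (Sym2 (Fin n)) | ω ∉ openConn o b ∧ ∃ i : Fin k, ω ∈ openConn o (a i.succ)} := by
      have h : (prodBernoulli (Function.update w s(o, a 0) 0))
            {ω : Set (Sym2 (Fin n)) | ω ∉ openConn o b ∧ ∃ i, ω ∈ openConn o (a i)} ≤
          (prodBernoulli (Function.update w s(o, a 0) 0))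
            {ω : Set (Sym2 (Fin n)) | ω ∉ openConn o b ∧ ∃ i : Fin k, ω ∈ openConn o (a i.succ)} := by
        refine measure_mono_ae (hae.mono fun ω hω hb => ?_)
        obtain ⟨hnb, i, hi⟩ := hb
        obtain ⟨y, hy, hoy⟩ := exists_first_pair (hao i) hi
        have h1 : Function.update w s(o, a 0) 0 s(o, y) ≠ 0 := fun h0 => hω _ h0 hy
        have h2 : s(o, y) ≠ s(o, a 0) := fun h => h1 (by rw [h, Function.update_self])
        have h3 : w s(o, y) ≠ 0 := by rwa [Function.update_of_ne h2] at h1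
        obtain ⟨j, rfl⟩ := hdep y hoy.symm h3
        have hj : j ≠ 0 := by
          rintro rfl
          exact h2 rfl
        obtain ⟨j', rfl⟩ := Fin.exists_succ_eq.2 hj
        exact ⟨hnb, j', ((openGraph_adj ω o _).2 ⟨hy, hoy⟩).reachable⟩
      exact ENNReal.toReal_mono (measure_ne_top _ _) h
    -- `μ(L_i) = μ(D_i) − μ⁺(D_i)`
    have hmi : Measurable fun ω : Set (Sym2 (Fin n)) => insert s(o, a 0) ω := by
      refine measurable_set_iff.2 fun i => ?_
      simp only [Set.mem_insert_iff]
      exact measurable_const.or (measurable_set_mem i)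
    have hL : ∀ i : Fin (k + 1),
        (prodBernoulli w).real {ω | ω ∉ openConn (a i) b ∧ insert s(o, a 0) ω ∈ openConn (a i) b} =
          (prodBernoulli w).real (openConn (a i) b)ᶜ -
            (prodBernoulli (Function.update w s(o, a 0) 1)).real (openConn (a i) b)ᶜ := by
      intro i
      have hset : {ω : Set (Sym2 (Fin n)) | ω ∉ openConn (a i) b ∧
            insert s(o, a 0) ω ∈ openConn (a i) b} =
          (openConn (a i) b)ᶜ \ ((fun ω => insert s(o, a 0) ω) ⁻¹' (openConn (a i) b)ᶜ) := by
        ext ω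
        simp only [Set.mem_setOf_eq, Set.mem_sdiff, Set.mem_compl_iff, Set.mem_preimage, not_not]
      have hsub : ((fun ω : Set (Sym2 (Fin n)) => insert s(o, a 0) ω) ⁻¹' (openConn (a i) b)ᶜ) ⊆
          (openConn (a i) b)ᶜ := fun ω hω hω' =>
        hω (isUpperSet_openConn (a i) b (Set.subset_insert s(o, a 0) ω) hω')
      rw [hset, measureReal_sdiff hsub MeasurableSet.of_discrete,
        ← map_measureReal_apply hmi MeasurableSet.of_discrete, goodStepEI_prodBernoulli_map_insert]
    -- pivotality domination (sequential hypothesis at `j = 0`)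
    have hw0 : (fun e => if ∃ l : Fin (k + 1), l < 0 ∧ e = s(o, a l) then (0 : unitInterval)
        else w e) = w := by
      funext e
      rw [if_neg]
      rintro ⟨l, hl, -⟩
      exact Fin.not_lt_zero l hl
    have hdom : ∀ i : Fin k,
        (prodBernoulli w).real {ω | ω ∉ openConn (a i.succ) b ∧
            insert s(o, a 0) ω ∈ openConn (a i.succ) b} ≤
          (prodBernoulli w).real {ω | ω ∉ openConn (a 0) b ∧
            insert s(o, a 0) ω ∈ openConn (a 0) b} := by
      intro i
      have h := hadm 0 i.succ (Fin.succ_pos i)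
      rw [hw0] at h
      exact stub_pivotalityDomination n w o (a 0) (a i.succ) b h
    -- ### assemble
    have hbad : (prodBernoulli w).real
          {ω : Set (Sym2 (Fin n)) | ω ∉ openConn o b ∧ ∃ i, ω ∈ openConn o (a i)} ≤
        (w s(o, a 0) : ℝ) * (prodBernoulli (Function.update w s(o, a 0) 1)).real (openConn (a 0) b)ᶜ +
          (1 - (w s(o, a 0) : ℝ)) * (prodBernoulli (Function.update w s(o, a 0) 0)).real
            {ω : Set (Sym2 (Fin n)) | ω ∉ openConn o b ∧ ∃ i : Fin k, ω ∈ openConn o (a i.succ)} := by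
      have hsplit : {ω : Set (Sym2 (Fin n)) | ω ∉ openConn o b ∧ ∃ i, ω ∈ openConn o (a i)} ⊆
          ({ω : Set (Sym2 (Fin n)) | ω ∉ openConn o b ∧ ∃ i, ω ∈ openConn o (a i)} ∩
              {ω | s(o, a 0) ∈ ω}) ∪
            ({ω : Set (Sym2 (Fin n)) | ω ∉ openConn o b ∧ ∃ i, ω ∈ openConn o (a i)} ∩
              {ω | s(o, a 0) ∉ ω}) := by
        intro ω hω
        by_cases he : s(o, a 0) ∈ ω
        · exact Or.inl ⟨hω, he⟩
        · exact Or.inr ⟨hω, he⟩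
      calc (prodBernoulli w).real
            {ω : Set (Sym2 (Fin n)) | ω ∉ openConn o b ∧ ∃ i, ω ∈ openConn o (a i)}
          ≤ (prodBernoulli w).real
              ({ω : Set (Sym2 (Fin n)) | ω ∉ openConn o b ∧ ∃ i, ω ∈ openConn o (a i)} ∩
                {ω | s(o, a 0) ∈ ω}) +
            (prodBernoulli w).real
              ({ω : Set (Sym2 (Fin n)) | ω ∉ openConn o b ∧ ∃ i, ω ∈ openConn o (a i)} ∩
                {ω | s(o, a 0) ∉ ω}) :=
            (measureReal_mono hsplit).trans (measureReal_union_le _ _)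
        _ ≤ (prodBernoulli w).real ((openConn (a 0) b)ᶜ ∩ {ω | s(o, a 0) ∈ ω}) +
            (prodBernoulli w).real
              ({ω : Set (Sym2 (Fin n)) | ω ∉ openConn o b ∧ ∃ i, ω ∈ openConn o (a i)} ∩
                {ω | s(o, a 0) ∉ ω}) :=
            add_le_add_left (measureReal_mono hopen) _
        _ = (w s(o, a 0) : ℝ) *
              (prodBernoulli (Function.update w s(o, a 0) 1)).real (openConn (a 0) b)ᶜ +
            (1 - (w s(o, a 0) : ℝ)) * (prodBernoulli (Function.update w s(o, a 0) 0)).real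
              {ω : Set (Sym2 (Fin n)) | ω ∉ openConn o b ∧ ∃ i, ω ∈ openConn o (a i)} := by
            rw [goodStepEI_real_inter_open_eq, goodStepEI_real_inter_closed_eq]
        _ ≤ _ :=
            add_le_add_right (mul_le_mul_of_nonneg_left hclosed (sub_nonneg.2 hp1)) _
    -- the target, split at `i = 0`
    have hT : ∑ i : Fin (k + 1), (w s(o, a i) : ℝ) *
          (∏ l ∈ Finset.univ.filter (fun l : Fin (k + 1) => l < i), (1 - (w s(o, a l) : ℝ))) *
            (prodBernoulli w).real (openConn (a i) b)ᶜ =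
        (w s(o, a 0) : ℝ) * 1 * (prodBernoulli w).real (openConn (a 0) b)ᶜ +
          ∑ i : Fin k, (w s(o, a i.succ) : ℝ) *
            ((1 - (w s(o, a 0) : ℝ)) *
              ∏ l ∈ Finset.univ.filter (fun l : Fin k => l < i), (1 - (w s(o, a l.succ) : ℝ))) *
            (prodBernoulli w).real (openConn (a i.succ) b)ᶜ := by
      rw [Fin.sum_univ_succ, prod_filter_lt_zero_one_sub]
      congr 1
      refine Finset.sum_congr rfl fun i _ => ?_
      rw [prod_filter_lt_succ (fun l => 1 - (w s(o, a l) : ℝ)) i]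
    rw [hT]
    refine algebra (q := fun i : Fin k => (w s(o, a i.succ) : ℝ))
      (P := fun i : Fin k => ∏ l ∈ Finset.univ.filter (fun l : Fin k => l < i),
        (1 - (w s(o, a l.succ) : ℝ)))
      (A := fun i : Fin k => (prodBernoulli (Function.update w s(o, a 0) 0)).real (openConn (a i.succ) b)ᶜ)
      (B := fun i : Fin k => (prodBernoulli (Function.update w s(o, a 0) 1)).real (openConn (a i.succ) b)ᶜ)
      (L := fun i : Fin k => (prodBernoulli w).real
        {ω | ω ∉ openConn (a i.succ) b ∧ insert s(o, a 0) ω ∈ openConn (a i.succ) b})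
      hp0 hp1 (fun i => ?_) ?_ (fun i => stub_oneBondDecomp_k15 n w s(o, a 0) _) (fun i => hL i.succ)
      (hL 0) measureReal_nonneg hdom hbad hIH
    · exact mul_nonneg (w _).2.1 (Finset.prod_nonneg fun l _ => sub_nonneg.2 (w _).2.2)
    · exact sum_mul_prod_le_one k (fun i => (w s(o, a i.succ) : ℝ)) (fun i => (w _).2.1)
        (fun i => (w _).2.2)

end Summit.CriticalPhenomena.PercolationContinuityZ3.Theorems
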